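import Summits.QuantumFields.YangMills.Theorems.BalabanUVNodesN19RekeyingAbsorption

/-!
# BalabanUVNodes ∕ node N19 (NE7) — THE n-BLOCK PRODUCT DATUM: p612537's pair of runs repeated independently over `m` blocks (volume `vol := m`).  At the FULL key the two-run
# class gap is EXTENSIVE (`m·log 3` between «no old large field» and «every block old-large-field») — no summable `Core` with empty bad class for ANY `m ≥ 1`; at the WINDOW key
# the SAME datum has `Core` ∧ `HybridNE7` with empty bad class at the PER-UNIT-VOLUME radius `u_K + 2·log(1 + η_K)` — INDEPENDENT of `m` (p610409 §3∕§4 BY NAME)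

Cell `pub-ymgap` (HUMAN RULING D-0062 Track A ∕ D-0149 width seats), WIDTH SEAT `pub-ymgap-dag-n19-w1` (node n19 = NE7, seat 1 of 3), generation g4, INTENT-6.  Route
`Summits/QuantumFields/YangMills/Theses/BalabanUVNodes.lean`, key item K3⁷ `SpineGivenEndpointR13SepCoPH` (stmt-QuantumFields-20544; v5 stub 2 `stub_expansion13H`, conjuncts N19′ ∧ N20);
filed `--kind proof --supports … --as helper`.  COUNT-NEUTRAL.  THEOREMS ONLY (0 `def`, 0 `sorry`).  ADDITIVE — imports this seat's g4 `…Theorems.BalabanUVNodesN19RekeyingAbsorption`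
(p610409: `prod_sandwich_of_blockwise`, `core_fibreSum_of_factorisation`, `hybridNE7_fibreSum_of_factorisation`; through it g3 `…N19HybridBeyondTarget.not_coreEdge_of_unsummable_gap` and
the tree's `Spine/NE7/Targets` (`Core`), `T4MatchingAssembly` (`HybridNE7`), `T4WeightBudget` (`RelWeightBound`)); modifies nothing.

WHY.  p610409 §4 says blockwise LR moduli ADD UP (an extensive budget `|B|·σ`), so the absorbed radius `(s_A+s_B)∕vol` is a PER-UNIT-VOLUME letter when `|B| ≍ vol`; idea-3 g9's
caricature says the full-key gap is extensive (`n_K·D₀`).  Both statements deserve ONE kernel datum carrying a genuine volume letter: THIS FILE takes p612537's `Bool × Bool` pair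
of runs independently over `m = n + 1` blocks and sets `vol := m`.
THE DATUM at level `K` (letters `κ_K > 0`, `u_K ≥ 0`, `0 ≤ η_K`): histories `(y, o)`, `y o : Fin m → Bool` (young ∕ old large field per block); run A
`p(y,o) = ∏_b k̄(y b)·(1 + η_K·[y b ∧ o b])` (`k̄(false) = 1`, `k̄(true) = κ_K`; old law uniform = SATURATED in every block), run B `q(y,o) = ∏_b 3^{[o b]}·k̄′(y b)·(1 + η_K·[y b ∧ o b])`
(`k̄′(true) = κ_K e^{u_K}`; the factor `3` per old block = an O(1) two-run mismatch per block, `3^m` in total).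
* §1 [folklore] per-block bounds (`blockCoupling_mem`, `youngFactor_sandwich`) and the blockwise factorisations of the two runs at the window key via p610409's
  `prod_sandwich_of_blockwise`: ★ `fac_window_A` ∕ ★ `fac_window_B` (LR modulus `m·log(1+η_K)` — EXTENSIVE), ★ `core_youngFactors` (`∏ k̄′ ∈ [1, e^{m u}]·∏ k̄`: `Core … (K ↦ u_K)` at
  `vol = m`, i.e. `u` PER UNIT VOLUME).
* §2 [folklore] ★★★ `window_key_core` — `Core l₀ m univ ∅ (Σ_o p) (Σ_o q) (K ↦ u_K + (m·log(1+η_K) + m·log(1+η_K))∕m)` (p610409 `core_fibreSum_of_factorisation` BY NAME; the `3^m` sits in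
  `c_K`) and ★★ `window_key_core_perUnitVolume` — the same with the radius SIMPLIFIED to `u_K + 2·log(1 + η_K)`: INDEPENDENT OF THE VOLUME `m`.  ★★ `window_key_hybridNE7` (+ empty bad
  class, zero shells, `u`, `η` summable).
* §3 [folklore] ★ `fullKey_gap` (the two classes «`y ≡ false`, `o ≡ false`» and «`y ≡ false`, `o ≡ true`» have two-run log-ratios `0` and `m·log 3`: an EXTENSIVE gap) · ★★
  `not_coreEdge_fullKey` (hence NO `δ` with `Core l₀ vol univ ∅ p q δ ∧ Summable δ` at the full key, whatever `vol`, for every `m ≥ 1` — g3's `not_coreEdge_of_unsummable_gap` BY NAME).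
READING (located; nothing proposed).  The volume letter behaves as the window-key road needs: what is extensive at the full key (old mismatch × number of blocks) is absorbed at the
window key, and what the window key charges is per unit volume (young matching `u` + old→young coupling `2·log(1+η)` per block).  Nothing here is Bałaban's.

HONEST FRAMING.  One explicit finite product datum (letters `κ, u, η` free sequences, `m` free) + [folklore] finite-product ∕ finite-sum arithmetic over the tree's SHAPES; nothing of
Bałaban's is asserted or instantiated; no estimate of the programme is proved.  NE7 ∕ NE7b NOT PRINTED as two-run statements for d = 4 ∕ NOT proved; N19 ∕ N20 NOT discharged; K3⁷
OPEN, not claimed, v5 untouched; counts UNMOVED (typed 28∕28 · discharged 5∕27, A 5∕28).  Everything below is PROVED (0 `sorry`, 0 named facts, standard axioms); no decl carries a cite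
tag.  One finite four-torus programme at fixed ε — NOT ℝ⁴, NOT infinite volume, NOT OS, NOT a mass gap, NOT the Clay problem (R4 closes the conditional finite-𝕋⁴ rung `BalabanLadder.UV` only).
-/

noncomputable section

open Finset
open scoped BigOperators

namespace Summit.QuantumFields.YangMills.BalabanUVNodes.N19BlockProductDatum

open Summit.QuantumFields.BalabanUV.T4Continuum.Spine.NE7 (Core)
open Literature.MathematicalPhysics.QuantumFieldTheory.Balaban1983to89
open T4WeightBudget (RelWeightBound)
open T4MatchingAssembly (HybridNE7)
open Summit.QuantumFields.YangMills.BalabanUVNodes.N19RekeyingAbsorption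
  (prod_sandwich_of_blockwise core_fibreSum_of_factorisation hybridNE7_fibreSum_of_factorisation)
open Summit.QuantumFields.YangMills.BalabanUVNodes.N19HybridBeyondTarget (not_coreEdge_of_unsummable_gap)

variable {n : ℕ} {κ u η : ℕ → ℝ}

/-! ## §1 Per-block bounds and the blockwise factorisations [folklore] -/

/-- The old→young coupling factor of one block lies in `[e^{−log(1+η)}, e^{log(1+η)}]·1` (`η ≥ 0`). [folklore] -/
theorem blockCoupling_mem {e : ℝ} (he : 0 ≤ e) (v w : Bool) :
    Real.exp (-Real.log (1 + e)) * (1 : ℝ) ≤ (if v && w then 1 + e else 1) ∧ (if v && w then 1 + e else (1 : ℝ)) ≤ Real.exp (Real.log (1 + e)) * 1 := by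
  have h1 : 0 < 1 + e := by linarith
  rw [Real.exp_neg, Real.exp_log h1, mul_one, mul_one]
  have hinv : (1 + e)⁻¹ ≤ 1 := inv_le_one_of_one_le₀ (by linarith)
  constructor <;> split_ifs <;> linarith

/-- The young two-run factor of one block: `k̄′(v) ∈ [e^{−u}, e^{u}]·k̄(v)` (`u ≥ 0`, `κ > 0`). [folklore] -/
theorem youngFactor_sandwich {k v0 : ℝ} (hk : 0 < k) (hv0 : 0 ≤ v0) (v : Bool) :
    Real.exp (-v0) * (if v then k else (1 : ℝ)) ≤ (if v then k * Real.exp v0 else 1) ∧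
      (if v then k * Real.exp v0 else (1 : ℝ)) ≤ Real.exp v0 * (if v then k else 1) := by
  have h1 : Real.exp (-v0) ≤ 1 := Real.exp_le_one_iff.mpr (by linarith)
  have h2 : 1 ≤ Real.exp v0 := Real.one_le_exp hv0
  cases v
  · simp only [Bool.false_eq_true, if_false, mul_one]
    exact ⟨h1, h2⟩
  · simp only [if_true]
    constructor
    · rw [mul_comm]; exact mul_le_mul_of_nonneg_left (h1.trans h2) hk.le
    · rw [mul_comm]

/-- **★ RUN A FACTORISES AT THE WINDOW KEY** [folklore]: `p(y,o) = (∏_b k̄(y b))·∏_b (1 + η[y b ∧ o b]) ∈ e^{±(m·log(1+η))}·(∏_b k̄(y b))·1` — class factor `∏ k̄`, profile `1`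
(the SATURATED old law), LR modulus `m·log(1+η_K)` (p610409 `prod_sandwich_of_blockwise`, `m = |Fin (n+1)|`). -/
theorem fac_window_A {l₀ : ℝ} (hκ : ∀ K, 0 < κ K) (hη : ∀ K, 0 ≤ η K) :
    ∀ (K : ℕ) (t : ℝ), |t| ≤ l₀ → ∀ y ∈ (Finset.univ : Finset (Fin (n + 1) → Bool)), ∀ o ∈ (Finset.univ : Finset (Fin (n + 1) → Bool)),
      Real.exp (-(((n + 1 : ℕ) : ℝ) * Real.log (1 + η K))) * ((∏ b, (if y b then κ K else (1 : ℝ))) * (1 : ℝ)) ≤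
          ∏ b, ((if y b then κ K else (1 : ℝ)) * (if y b && o b then 1 + η K else 1)) ∧
        ∏ b, ((if y b then κ K else (1 : ℝ)) * (if y b && o b then 1 + η K else 1)) ≤
          Real.exp (((n + 1 : ℕ) : ℝ) * Real.log (1 + η K)) * ((∏ b, (if y b then κ K else (1 : ℝ))) * (1 : ℝ)) := by
  intro K t _ y _ o _
  have hm : 0 ≤ ∏ b : Fin (n + 1), (if y b then κ K else (1 : ℝ)) :=
    Finset.prod_nonneg fun b _ => by split_ifs <;> [exact (hκ K).le; exact zero_le_one]
  obtain ⟨hlo, hhi⟩ := prod_sandwich_of_blockwise (B := (Finset.univ : Finset (Fin (n + 1)))) (ψ := fun _ => (1 : ℝ))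
    (φ := fun b => if y b && o b then 1 + η K else (1 : ℝ)) (s₀ := Real.log (1 + η K)) (fun _ _ => zero_le_one) fun b _ => blockCoupling_mem (hη K) (y b) (o b)
  rw [Finset.card_univ, Fintype.card_fin, Finset.prod_const_one, mul_one] at hlo hhi
  rw [Finset.prod_mul_distrib, mul_one]
  constructor
  · calc Real.exp (-((((n + 1 : ℕ) : ℝ)) * Real.log (1 + η K))) * ∏ b, (if y b then κ K else (1 : ℝ))
        = (∏ b, (if y b then κ K else (1 : ℝ))) * Real.exp (-((((n + 1 : ℕ) : ℝ)) * Real.log (1 + η K))) := mul_comm _ _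
      _ ≤ (∏ b, (if y b then κ K else (1 : ℝ))) * ∏ b, (if y b && o b then 1 + η K else (1 : ℝ)) := mul_le_mul_of_nonneg_left hlo hm
  · calc (∏ b, (if y b then κ K else (1 : ℝ))) * ∏ b, (if y b && o b then 1 + η K else (1 : ℝ))
        ≤ (∏ b, (if y b then κ K else (1 : ℝ))) * Real.exp ((((n + 1 : ℕ) : ℝ)) * Real.log (1 + η K)) := mul_le_mul_of_nonneg_left hhi hm
      _ = Real.exp ((((n + 1 : ℕ) : ℝ)) * Real.log (1 + η K)) * ∏ b, (if y b then κ K else (1 : ℝ)) := mul_comm _ _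

/-- **★ RUN B FACTORISES AT THE WINDOW KEY** [folklore]: `q(y,o) = (∏_b k̄′(y b))·∏_b 3^{[o b]}(1 + η[…]) ∈ e^{±(m·log(1+η))}·(∏_b k̄′(y b))·(∏_b 3^{[o b]})` — profile `∏_b 3^{[o b]}`, the
old structure's run-B weight, MISMATCHED against run A's `1` by the extensive factor `3^{#old}`. -/
theorem fac_window_B {l₀ : ℝ} (hκ : ∀ K, 0 < κ K) (hη : ∀ K, 0 ≤ η K) :
    ∀ (K : ℕ) (t : ℝ), |t| ≤ l₀ → ∀ y ∈ (Finset.univ : Finset (Fin (n + 1) → Bool)), ∀ o ∈ (Finset.univ : Finset (Fin (n + 1) → Bool)),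
      Real.exp (-(((n + 1 : ℕ) : ℝ) * Real.log (1 + η K))) * ((∏ b, (if y b then κ K * Real.exp (u K) else (1 : ℝ))) * ∏ b, (if o b then (3 : ℝ) else 1)) ≤
          ∏ b, ((if o b then (3 : ℝ) else 1) * (if y b then κ K * Real.exp (u K) else 1) * (if y b && o b then 1 + η K else 1)) ∧
        ∏ b, ((if o b then (3 : ℝ) else 1) * (if y b then κ K * Real.exp (u K) else 1) * (if y b && o b then 1 + η K else 1)) ≤
          Real.exp (((n + 1 : ℕ) : ℝ) * Real.log (1 + η K)) * ((∏ b, (if y b then κ K * Real.exp (u K) else (1 : ℝ))) * ∏ b, (if o b then (3 : ℝ) else 1)) := by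
  intro K t _ y _ o _
  have hm : 0 ≤ ∏ b : Fin (n + 1), (if y b then κ K * Real.exp (u K) else (1 : ℝ)) :=
    Finset.prod_nonneg fun b _ => by split_ifs <;> [exact (mul_pos (hκ K) (Real.exp_pos _)).le; exact zero_le_one]
  obtain ⟨hlo, hhi⟩ := prod_sandwich_of_blockwise (B := (Finset.univ : Finset (Fin (n + 1)))) (ψ := fun b => if o b then (3 : ℝ) else 1)
    (φ := fun b => (if o b then (3 : ℝ) else 1) * (if y b && o b then 1 + η K else (1 : ℝ))) (s₀ := Real.log (1 + η K))
    (fun b _ => by split_ifs <;> norm_num) fun b _ => by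
      obtain ⟨h1, h2⟩ := blockCoupling_mem (hη K) (y b) (o b)
      have h3 : 0 ≤ (if o b then (3 : ℝ) else 1) := by split_ifs <;> norm_num
      rw [mul_one] at h1 h2
      constructor
      · calc Real.exp (-Real.log (1 + η K)) * (if o b then (3 : ℝ) else 1) = (if o b then (3 : ℝ) else 1) * Real.exp (-Real.log (1 + η K)) := mul_comm _ _
          _ ≤ (if o b then (3 : ℝ) else 1) * (if y b && o b then 1 + η K else 1) := mul_le_mul_of_nonneg_left h1 h3
      · calc (if o b then (3 : ℝ) else 1) * (if y b && o b then 1 + η K else 1) ≤ (if o b then (3 : ℝ) else 1) * Real.exp (Real.log (1 + η K)) := mul_le_mul_of_nonneg_left h2 h3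
          _ = Real.exp (Real.log (1 + η K)) * (if o b then (3 : ℝ) else 1) := mul_comm _ _
  rw [Finset.card_univ, Fintype.card_fin] at hlo hhi
  have hre : ∏ b, ((if o b then (3 : ℝ) else 1) * (if y b then κ K * Real.exp (u K) else 1) * (if y b && o b then 1 + η K else 1))
      = (∏ b, (if y b then κ K * Real.exp (u K) else (1 : ℝ))) * ∏ b, ((if o b then (3 : ℝ) else 1) * (if y b && o b then 1 + η K else (1 : ℝ))) := by
    rw [← Finset.prod_mul_distrib]
    exact Finset.prod_congr rfl fun b _ => by ring
  rw [hre]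
  constructor
  · calc Real.exp (-((((n + 1 : ℕ) : ℝ)) * Real.log (1 + η K))) * ((∏ b, (if y b then κ K * Real.exp (u K) else (1 : ℝ))) * ∏ b, (if o b then (3 : ℝ) else 1))
        = (∏ b, (if y b then κ K * Real.exp (u K) else (1 : ℝ))) * (Real.exp (-((((n + 1 : ℕ) : ℝ)) * Real.log (1 + η K))) * ∏ b, (if o b then (3 : ℝ) else 1)) := by ring
      _ ≤ (∏ b, (if y b then κ K * Real.exp (u K) else (1 : ℝ))) * ∏ b, ((if o b then (3 : ℝ) else 1) * (if y b && o b then 1 + η K else (1 : ℝ))) :=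
          mul_le_mul_of_nonneg_left hlo hm
  · calc (∏ b, (if y b then κ K * Real.exp (u K) else (1 : ℝ))) * ∏ b, ((if o b then (3 : ℝ) else 1) * (if y b && o b then 1 + η K else (1 : ℝ)))
        ≤ (∏ b, (if y b then κ K * Real.exp (u K) else (1 : ℝ))) * (Real.exp ((((n + 1 : ℕ) : ℝ)) * Real.log (1 + η K)) * ∏ b, (if o b then (3 : ℝ) else 1)) :=
          mul_le_mul_of_nonneg_left hhi hm
      _ = Real.exp ((((n + 1 : ℕ) : ℝ)) * Real.log (1 + η K)) * ((∏ b, (if y b then κ K * Real.exp (u K) else (1 : ℝ))) * ∏ b, (if o b then (3 : ℝ) else 1)) := by ring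

/-- **★ THE YOUNG CLASS FACTORS MATCH AT `u` PER UNIT VOLUME** [folklore]: `∏_b k̄′(y b) ∈ [e^{−m u}, e^{m u}]·∏_b k̄(y b)`, i.e. `Core l₀ m univ ∅ (∏ k̄) (∏ k̄′) (K ↦ u_K)` with constant
`0` at volume `vol := m` — the young two-run mismatch is `u_K` PER BLOCK. -/
theorem core_youngFactors {l₀ : ℝ} (hκ : ∀ K, 0 < κ K) (hu : ∀ K, 0 ≤ u K) :
    Core l₀ ((n + 1 : ℕ) : ℝ) (fun _ => (Finset.univ : Finset (Fin (n + 1) → Bool))) (fun _ _ => (∅ : Finset (Fin (n + 1) → Bool)))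
      (fun K _ y => ∏ b, (if y b then κ K else (1 : ℝ))) (fun K _ y => ∏ b, (if y b then κ K * Real.exp (u K) else (1 : ℝ))) (fun K => u K) := by
  intro K
  refine ⟨0, fun t _ y _ => ?_⟩
  obtain ⟨hlo, hhi⟩ := prod_sandwich_of_blockwise (B := (Finset.univ : Finset (Fin (n + 1)))) (ψ := fun b => if y b then κ K else (1 : ℝ))
    (φ := fun b => if y b then κ K * Real.exp (u K) else (1 : ℝ)) (s₀ := u K)
    (fun b _ => by split_ifs <;> [exact (hκ K).le; exact zero_le_one]) fun b _ => youngFactor_sandwich (hκ K) (hu K) (y b)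
  rw [Finset.card_univ, Fintype.card_fin] at hlo hhi
  rw [zero_sub, zero_add]
  exact ⟨by simpa using hlo, by simpa using hhi⟩

/-! ## §2 The window key: `Core` and `HybridNE7` at a per-unit-volume radius [folklore] -/

/-- **★★★ THE WINDOW-KEY `Core` OF THE n-BLOCK DATUM** [folklore] (p610409 `core_fibreSum_of_factorisation` BY NAME at `vol := m = n + 1`): summing out the old structure, the young
classes' fibre sums match modulo constants with EMPTY bad class at radius `u_K + (m·log(1+η_K) + m·log(1+η_K))∕m`; the extensive old mismatch `3^{#old}` and the saturated old law sit in
`c_K = log((4∕2)^m) = m·log 2`. -/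
theorem window_key_core {l₀ : ℝ} (hκ : ∀ K, 0 < κ K) (hu : ∀ K, 0 ≤ u K) (hη : ∀ K, 0 ≤ η K) :
    Core l₀ ((n + 1 : ℕ) : ℝ) (fun _ => (Finset.univ : Finset (Fin (n + 1) → Bool))) (fun _ _ => (∅ : Finset (Fin (n + 1) → Bool)))
      (fun K _ y => ∑ o ∈ (Finset.univ : Finset (Fin (n + 1) → Bool)), ∏ b, ((if y b then κ K else (1 : ℝ)) * (if y b && o b then 1 + η K else 1)))
      (fun K _ y => ∑ o ∈ (Finset.univ : Finset (Fin (n + 1) → Bool)),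
        ∏ b, ((if o b then (3 : ℝ) else 1) * (if y b then κ K * Real.exp (u K) else 1) * (if y b && o b then 1 + η K else 1)))
      (fun K => u K + (((n + 1 : ℕ) : ℝ) * Real.log (1 + η K) + ((n + 1 : ℕ) : ℝ) * Real.log (1 + η K)) / ((n + 1 : ℕ) : ℝ)) :=
  core_fibreSum_of_factorisation (O := fun _ => (Finset.univ : Finset (Fin (n + 1) → Bool))) (φA := fun _ _ => (1 : ℝ))
    (φB := fun _ o => ∏ b, (if o b then (3 : ℝ) else 1))
    (p := fun K (_ : ℝ) (x : (Fin (n + 1) → Bool) × (Fin (n + 1) → Bool)) => ∏ b, ((if x.1 b then κ K else (1 : ℝ)) * (if x.1 b && x.2 b then 1 + η K else 1)))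
    (q := fun K (_ : ℝ) (x : (Fin (n + 1) → Bool) × (Fin (n + 1) → Bool)) =>
      ∏ b, ((if x.2 b then (3 : ℝ) else 1) * (if x.1 b then κ K * Real.exp (u K) else 1) * (if x.1 b && x.2 b then 1 + η K else 1)))
    (mA := fun K (_ : ℝ) (y : Fin (n + 1) → Bool) => ∏ b, (if y b then κ K else (1 : ℝ)))
    (mB := fun K (_ : ℝ) (y : Fin (n + 1) → Bool) => ∏ b, (if y b then κ K * Real.exp (u K) else (1 : ℝ)))
    (sA := fun K => ((n + 1 : ℕ) : ℝ) * Real.log (1 + η K)) (sB := fun K => ((n + 1 : ℕ) : ℝ) * Real.log (1 + η K)) (r := fun K => u K)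
    (by positivity) (fac_window_A hκ hη) (fac_window_B hκ hη)
    (fun K _ _ y _ => Finset.prod_nonneg fun b _ => by split_ifs <;> [exact (hκ K).le; exact zero_le_one])
    (fun _ o _ => Finset.prod_nonneg fun b _ => by split_ifs <;> norm_num)
    (fun _ => by simp)
    (fun _ => Finset.sum_pos (fun o _ => Finset.prod_pos fun b _ => by split_ifs <;> norm_num) Finset.univ_nonempty)
    (core_youngFactors hκ hu)

/-- **★★ … AT THE PER-UNIT-VOLUME RADIUS `u_K + 2·log(1 + η_K)`, INDEPENDENT OF THE VOLUME** [folklore]: the same statement with the radius simplified — for every number of blocks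
`m = n + 1` the window key charges young matching `u_K` plus the old→young coupling `2·log(1+η_K)`, per block, and nothing for the old mismatch. -/
theorem window_key_core_perUnitVolume {l₀ : ℝ} (hκ : ∀ K, 0 < κ K) (hu : ∀ K, 0 ≤ u K) (hη : ∀ K, 0 ≤ η K) :
    Core l₀ ((n + 1 : ℕ) : ℝ) (fun _ => (Finset.univ : Finset (Fin (n + 1) → Bool))) (fun _ _ => (∅ : Finset (Fin (n + 1) → Bool)))
      (fun K _ y => ∑ o ∈ (Finset.univ : Finset (Fin (n + 1) → Bool)), ∏ b, ((if y b then κ K else (1 : ℝ)) * (if y b && o b then 1 + η K else 1)))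
      (fun K _ y => ∑ o ∈ (Finset.univ : Finset (Fin (n + 1) → Bool)),
        ∏ b, ((if o b then (3 : ℝ) else 1) * (if y b then κ K * Real.exp (u K) else 1) * (if y b && o b then 1 + η K else 1)))
      (fun K => u K + 2 * Real.log (1 + η K)) := by
  have hrad : (fun K => u K + (((n + 1 : ℕ) : ℝ) * Real.log (1 + η K) + ((n + 1 : ℕ) : ℝ) * Real.log (1 + η K)) / ((n + 1 : ℕ) : ℝ))
      = fun K => u K + 2 * Real.log (1 + η K) := by
    funext K
    have hm : ((n + 1 : ℕ) : ℝ) ≠ 0 := by positivity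
    field_simp
    ring
  rw [← hrad]
  exact window_key_core hκ hu hη

/-- **★★ THE FULL BINDER LIST AT THE WINDOW KEY, EMPTY BAD CLASS** [folklore]: with `u`, `η` non-negative and summable, `HybridNE7 l₀ m univ (Σ_o p) (Σ_o q) ∅ 0 0 0 0
(K ↦ u_K + (m log(1+η_K) + m log(1+η_K))∕m)` (p610409 `hybridNE7_fibreSum_of_factorisation` BY NAME; `RelWeightBound` = the trivial empty-class datum). -/
theorem window_key_hybridNE7 {l₀ : ℝ} (hκ : ∀ K, 0 < κ K) (hu0 : ∀ K, 0 ≤ u K) (hu : Summable u) (hη0 : ∀ K, 0 ≤ η K) (hη : Summable η) :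
    HybridNE7 l₀ ((n + 1 : ℕ) : ℝ) (fun _ => (Finset.univ : Finset (Fin (n + 1) → Bool)))
      (fun K _ y => ∑ o ∈ (Finset.univ : Finset (Fin (n + 1) → Bool)), ∏ b, ((if y b then κ K else (1 : ℝ)) * (if y b && o b then 1 + η K else 1)))
      (fun K _ y => ∑ o ∈ (Finset.univ : Finset (Fin (n + 1) → Bool)),
        ∏ b, ((if o b then (3 : ℝ) else 1) * (if y b then κ K * Real.exp (u K) else 1) * (if y b && o b then 1 + η K else 1)))
      (fun _ _ => (∅ : Finset (Fin (n + 1) → Bool))) (fun _ => 0) (fun _ _ _ => 0) (fun _ _ _ => 0) (fun _ => 0)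
      (fun K => u K + (((n + 1 : ℕ) : ℝ) * Real.log (1 + η K) + ((n + 1 : ℕ) : ℝ) * Real.log (1 + η K)) / ((n + 1 : ℕ) : ℝ)) := by
  have hlog : Summable fun K => Real.log (1 + η K) := by
    refine Summable.of_nonneg_of_le (fun K => Real.log_nonneg (by linarith [hη0 K])) (fun K => ?_) hη
    have h := Real.log_le_sub_one_of_pos (show 0 < 1 + η K by linarith [hη0 K])
    linarith
  have hrad : Summable fun K => u K + (((n + 1 : ℕ) : ℝ) * Real.log (1 + η K) + ((n + 1 : ℕ) : ℝ) * Real.log (1 + η K)) / ((n + 1 : ℕ) : ℝ) :=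
    hu.add (((hlog.mul_left _).add (hlog.mul_left _)).div_const _)
  have hW : RelWeightBound l₀ (fun _ => (Finset.univ : Finset (Fin (n + 1) → Bool)))
      (fun K (_ : ℝ) y => ∑ o ∈ (Finset.univ : Finset (Fin (n + 1) → Bool)), ∏ b, ((if y b then κ K else (1 : ℝ)) * (if y b && o b then 1 + η K else 1)))
      (fun K (_ : ℝ) y => ∑ o ∈ (Finset.univ : Finset (Fin (n + 1) → Bool)),
        ∏ b, ((if o b then (3 : ℝ) else 1) * (if y b then κ K * Real.exp (u K) else 1) * (if y b && o b then 1 + η K else 1)))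
      (fun _ _ => (∅ : Finset (Fin (n + 1) → Bool))) (fun _ => 0) :=
    { bad_subset := fun _ _ _ => Finset.empty_subset _
      nonneg := fun _ => le_rfl
      lt_one := fun _ => zero_lt_one
      summable := summable_zero
      bad_left := fun _ _ _ => by simp
      bad_right := fun _ _ _ => by simp }
  refine hybridNE7_fibreSum_of_factorisation (O := fun _ => (Finset.univ : Finset (Fin (n + 1) → Bool))) (φA := fun _ _ => (1 : ℝ))
    (φB := fun _ o => ∏ b, (if o b then (3 : ℝ) else 1))
    (p := fun K (_ : ℝ) (x : (Fin (n + 1) → Bool) × (Fin (n + 1) → Bool)) => ∏ b, ((if x.1 b then κ K else (1 : ℝ)) * (if x.1 b && x.2 b then 1 + η K else 1)))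
    (q := fun K (_ : ℝ) (x : (Fin (n + 1) → Bool) × (Fin (n + 1) → Bool)) =>
      ∏ b, ((if x.2 b then (3 : ℝ) else 1) * (if x.1 b then κ K * Real.exp (u K) else 1) * (if x.1 b && x.2 b then 1 + η K else 1)))
    (mA := fun K (_ : ℝ) (y : Fin (n + 1) → Bool) => ∏ b, (if y b then κ K else (1 : ℝ)))
    (mB := fun K (_ : ℝ) (y : Fin (n + 1) → Bool) => ∏ b, (if y b then κ K * Real.exp (u K) else (1 : ℝ)))
    (sA := fun K => ((n + 1 : ℕ) : ℝ) * Real.log (1 + η K)) (sB := fun K => ((n + 1 : ℕ) : ℝ) * Real.log (1 + η K)) (r := fun K => u K)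
    (by positivity) (fac_window_A hκ hη0) (fac_window_B hκ hη0)
    (fun K _ _ y _ => Finset.prod_nonneg fun b _ => by split_ifs <;> [exact (hκ K).le; exact zero_le_one])
    (fun _ o _ => Finset.prod_nonneg fun b _ => by split_ifs <;> norm_num)
    (fun _ => by simp)
    (fun _ => Finset.sum_pos (fun o _ => Finset.prod_pos fun b _ => by split_ifs <;> norm_num) Finset.univ_nonempty)
    (core_youngFactors hκ hu0) ?_ ?_ hW hrad
  · intro K _ _ y _ o _
    have := hκ K; have := hη0 K
    exact Finset.prod_nonneg fun b _ => by apply mul_nonneg <;> split_ifs <;> positivity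
  · intro K _ _ y _ o _
    have := hκ K; have := hη0 K
    exact Finset.prod_nonneg fun b _ => by
      apply mul_nonneg
      · apply mul_nonneg <;> split_ifs <;> positivity
      · split_ifs <;> positivity

/-! ## §3 The full key: an extensive gap, no summable `Core` for any volume [folklore] -/

/-- **★ THE EXTENSIVE FULL-KEY GAP** [folklore]: at the full key (classes = `(y, o)`) the class «no young, no old large field» has two-run ratio `1` and the class «no young, every
block old-large-field» has ratio `3^m`: their log-ratio gap is `m·log 3` — EXTENSIVE in the number of blocks. -/
theorem fullKey_gap (K : ℕ) :
    (Real.log (∏ b : Fin (n + 1), ((if (fun _ => true) b then (3 : ℝ) else 1) * (if (fun _ : Fin (n + 1) => false) b then κ K * Real.exp (u K) else 1) *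
        (if (fun _ : Fin (n + 1) => false) b && (fun _ => true) b then 1 + η K else 1))) -
      Real.log (∏ b : Fin (n + 1), ((if (fun _ : Fin (n + 1) => false) b then κ K else (1 : ℝ)) * (if (fun _ : Fin (n + 1) => false) b && (fun _ => true) b then 1 + η K else 1)))) -
    (Real.log (∏ b : Fin (n + 1), ((if (fun _ => false) b then (3 : ℝ) else 1) * (if (fun _ : Fin (n + 1) => false) b then κ K * Real.exp (u K) else 1) *
        (if (fun _ : Fin (n + 1) => false) b && (fun _ => false) b then 1 + η K else 1))) -
      Real.log (∏ b : Fin (n + 1), ((if (fun _ : Fin (n + 1) => false) b then κ K else (1 : ℝ)) * (if (fun _ : Fin (n + 1) => false) b && (fun _ => false) b then 1 + η K else 1))))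
      = ((n + 1 : ℕ) : ℝ) * Real.log 3 := by
  simp only [Bool.false_and, if_true, Bool.false_eq_true, if_false, mul_one, Finset.prod_const_one, Real.log_one, sub_zero,
    Finset.prod_const, Finset.card_univ, Fintype.card_fin, Real.log_pow]

/-- **★★ NO SUMMABLE `Core` AT THE FULL KEY, ANY VOLUME** [folklore]: for every `m = n + 1 ≥ 1`, every `l₀ ≥ 0` and every volume letter `vol`, the datum at the full key with EMPTY bad class
admits NO `δ` with `Core … δ ∧ Summable δ` — the gap `m·log 3 ≥ log 3` does not tend to zero (g3's `not_coreEdge_of_unsummable_gap` BY NAME).  (At `vol := m` the condition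
`m·log 3 ≤ 2m·δ_K` reads `δ_K ≥ (log 3)∕2` PER UNIT VOLUME: the old mismatch is an O(1)-per-block rate, never summable.) -/
theorem not_coreEdge_fullKey {l₀ : ℝ} (vol : ℝ) (hl₀ : 0 ≤ l₀) :
    ¬ ∃ δ : ℕ → ℝ, Core l₀ vol (fun _ => (Finset.univ : Finset ((Fin (n + 1) → Bool) × (Fin (n + 1) → Bool)))) (fun _ _ => ∅)
        (fun K _ x => ∏ b, ((if x.1 b then κ K else (1 : ℝ)) * (if x.1 b && x.2 b then 1 + η K else 1)))
        (fun K _ x => ∏ b, ((if x.2 b then (3 : ℝ) else 1) * (if x.1 b then κ K * Real.exp (u K) else 1) * (if x.1 b && x.2 b then 1 + η K else 1))) δ ∧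
      Summable δ := by
  have hg : 0 < ((n + 1 : ℕ) : ℝ) * Real.log 3 := mul_pos (by positivity) (Real.log_pos (by norm_num))
  refine not_coreEdge_of_unsummable_gap (g := fun _ => ((n + 1 : ℕ) : ℝ) * Real.log 3) (fun _ => hg.le) ?_ fun K => ?_
  · intro hs
    exact hg.ne' (tendsto_nhds_unique tendsto_const_nhds hs.tendsto_atTop_zero)
  · refine ⟨0, by simpa using hl₀, ((fun _ => false), (fun _ => true)), by simp, ((fun _ => false), (fun _ => false)), by simp, ?_, ?_, ?_⟩
    · exact Finset.prod_pos fun b _ => by simp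
    · exact Finset.prod_pos fun b _ => by simp
    · exact (fullKey_gap (κ := κ) (u := u) (η := η) K).ge

end Summit.QuantumFields.YangMills.BalabanUVNodes.N19BlockProductDatum
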